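import Literature.AnabelianGeometry.SemiGraphs.PSCUnrLevelPackage
import Literature.AnabelianGeometry.SemiGraphs.PSCLevelwiseCofinal
import HarnessLib

/-!
# [CombGC] Thm. 1.6 (ii): "it suffices to verify (iii)" — level-wise group-theoretic verticiality of the
# induced `β_U : Π^unr_{G_U} ≅ Π^unr_{H_{U'}}` below a sturdy level implies that `α` is group-theoretically
# verticial (ONE-CALL entry point of the descent)

Mochizuki, *A combinatorial version of the Grothendieck conjecture*, Tohoku Math. J. **59** (2007) [CombGC],
proof of Theorem 1.6 (ii), author's ms p. 14 l.22–31: "`α` induces a verticially filtration-preserving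
isomorphism `Π^unr_G ⥲ Π^unr_H`.  Now to prove that `α` is group-theoretically verticial, it suffices to prove
[cf. the proof of assertion (i)] that `α` induces a functorial bijection between the sets of vertices of `G`,
`H`.  Thus … it suffices to prove that `β` is group-theoretically verticial, that is to say, it suffices to
verify assertion (iii)" (render `paper:url-6994f81053dc` p0014). [cite: MochizukiCombGC2007, Thm 1.6(ii) p.14]

PROOF-ONLY file (abc-iut cell, layer L3, `plan/L3/SUBDAG-CombGC-Thm16.md` row T16-L09b, holder
abc-iut-w5-d188; the single entry point asked for by the (ii)-assembly seats, cf. abc-iut-w5-d212's §5′).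
**`isGroupTheoreticallyVerticial_of_levelwise_unrVerticial`**: for profinite `Π_G`, `Π_H`, `α : Π_G ≅ Π_H` and an
open normal `U₀ ≤ Π_G` (the sturdy characteristic level of Rmk. 1.1.5): if at EVERY open normal `U ≤ U₀`, with
`U' := α U`, the coverings `G.restrictBD U`, `H.restrictBD U'` (abc-iut-L3-t4, any branch data) carry an
isomorphism `β_U : Π^unr_{G_U} ≅ Π^unr_{H_{U'}}` over `α|_U` which is GROUP-THEORETICALLY VERTICIAL
(`IsUnrGroupTheoreticallyVerticial` — the conclusion of Thm. 1.6 (iii) at that level) and both coverings are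
sturdy with Prop. 1.2 (i), unramified case (`UnrVerticialOpenInterDeterminesVertex`, BY NAME), then `α` is
group-theoretically verticial (Def. 1.4 (iv)).  Composition of `graphic_mod_package_unr` (p427473) with
`isGroupTheoreticallyVerticial_of_graphic_mod_le` (p427370); the finite index of open subgroups of the compact
`Π_G`, `Π_H` and the normality of `α U` are supplied here, so the caller provides only the level data.
No definitions; nothing here takes a side on [IUTchIII] Cor. 3.12.
-/

noncomputable section

namespace Literature.AnabelianGeometry.SemiGraphs

namespace PSCDatum

open scoped Pointwise

universe u

variable {P : Type u} [Group P] [TopologicalSpace P]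
variable {P' : Type u} [Group P'] [TopologicalSpace P']
variable [IsTopologicalGroup P] [CompactSpace P] [TotallyDisconnectedSpace P]
variable [IsTopologicalGroup P'] [CompactSpace P'] [TotallyDisconnectedSpace P']

omit [TotallyDisconnectedSpace P] in
/-- An open subgroup of the compact `Π_G` has finite index. [cite: MochizukiCombGC2007, Def 1.1(ii) p.6] -/
private theorem finiteIndex_of_isOpen' (U : Subgroup P) (hU : IsOpen (U : Set P)) : U.FiniteIndex := by
  haveI : DiscreteTopology (P ⧸ U) := QuotientGroup.discreteTopology_iff.mpr hU
  haveI : Finite (P ⧸ U) := finite_of_compact_of_discrete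
  exact Subgroup.finiteIndex_of_finite_quotient

variable (G : PSCDatum P) (H : PSCDatum P') (α : P ≃ₜ* P')

/-- **[CombGC] Thm. 1.6 (ii), "it suffices to verify assertion (iii)", ONE-CALL FORM.**  Let `Π_G`, `Π_H` be
profinite, `α : Π_G ≅ Π_H`, `U₀ ≤ Π_G` open normal.  Suppose that for every open normal `U ≤ U₀` (finite index
supplied), writing `U' := α U`, there are branch data, an open-ness witness for `U'`, an isomorphism
`αU : U ≅ U'` restricting `α`, and an isomorphism `β_U : Π_{G_U} ⧸ Ker(↠ Π^unr) ≅ Π_{H_{U'}} ⧸ Ker(↠ Π^unr)` over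
`αU` such that `β_U` is group-theoretically verticial and both coverings `G.restrictBD U`, `H.restrictBD U'`
are sturdy and satisfy Prop. 1.2 (i) (unramified).  Then `α` is group-theoretically verticial.
[cite: MochizukiCombGC2007, Thm 1.6(ii) p.14] -/
theorem isGroupTheoreticallyVerticial_of_levelwise_unrVerticial {U₀ : Subgroup P} (hU₀n : U₀.Normal)
    (hU₀o : IsOpen (U₀ : Set P))
    (h : ∀ (U : Subgroup P) [U.Normal] [U.FiniteIndex] (hUo : IsOpen (U : Set P)), U ≤ U₀ →
      ∀ [(U.map α.toMulEquiv.toMonoidHom).Normal] [(U.map α.toMulEquiv.toMonoidHom).FiniteIndex],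
      ∃ (bd : G.BranchData) (bd' : H.BranchData)
        (hU'o : IsOpen ((U.map α.toMulEquiv.toMonoidHom : Subgroup P') : Set P'))
        (αU : U ≃ₜ* (U.map α.toMulEquiv.toMonoidHom))
        (_ : ∀ u : U, ((αU u : (U.map α.toMulEquiv.toMonoidHom : Subgroup P')) : P') = α u)
        (β : (U ⧸ (G.restrictBD U hUo bd).unrKer) ≃ₜ*
          ((U.map α.toMulEquiv.toMonoidHom) ⧸ (H.restrictBD (U.map α.toMulEquiv.toMonoidHom) hU'o bd').unrKer))
        (_ : ∀ u : U, β (QuotientGroup.mk' (G.restrictBD U hUo bd).unrKer u) =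
          QuotientGroup.mk' (H.restrictBD (U.map α.toMulEquiv.toMonoidHom) hU'o bd').unrKer (αU u)),
        (G.restrictBD U hUo bd).IsUnrGroupTheoreticallyVerticial
            (H.restrictBD (U.map α.toMulEquiv.toMonoidHom) hU'o bd') β ∧
          (G.restrictBD U hUo bd).UnrVerticialOpenInterDeterminesVertex ∧ (G.restrictBD U hUo bd).IsSturdy ∧
          (H.restrictBD (U.map α.toMulEquiv.toMonoidHom) hU'o bd').UnrVerticialOpenInterDeterminesVertex ∧
          (H.restrictBD (U.map α.toMulEquiv.toMonoidHom) hU'o bd').IsSturdy) :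
    G.IsGroupTheoreticallyVerticial H α := by
  refine isGroupTheoreticallyVerticial_of_graphic_mod_le α G H hU₀n hU₀o fun U hUn hUo hle => ?_
  haveI := hUn
  haveI : U.FiniteIndex := finiteIndex_of_isOpen' U hUo
  haveI : (U.map α.toMulEquiv.toMonoidHom).Normal := Subgroup.Normal.map hUn _ α.surjective
  have hU'o' : IsOpen ((U.map α.toMulEquiv.toMonoidHom : Subgroup P') : Set P') := by
    rw [Subgroup.coe_map]; exact α.isOpenMap _ hUo
  haveI : (U.map α.toMulEquiv.toMonoidHom).FiniteIndex := finiteIndex_of_isOpen' _ hU'o'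
  obtain ⟨bd, bd', hU'o, αU, hαU, β, hβ, hgt, hVG, hsG, hVH, hsH⟩ := h U hUo hle
  exact graphic_mod_package_unr G H α U hUo bd (U.map α.toMulEquiv.toMonoidHom) hU'o bd' rfl αU hαU β hβ
    hgt hVG hsG hVH hsH

end PSCDatum

end Literature.AnabelianGeometry.SemiGraphs
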